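import Summits.ValiantsHypothesis.ValiantsHypothesis.Theorems.LacunarySymmetroidMatrixDescartesCensusTopKill
import Summits.ValiantsHypothesis.ValiantsHypothesis.Theorems.LacunarySymmetroidMatrixDescartesCensusEndKill

/-!
# `MatrixDescartes` census — THEOREM N′ (WINDOW LEMMA) in the kernel: Newton's inequality at ALTERNATING triples

HONEST FRAMING.  Object-search cell `pub-symmetroid`, route crux `Theses.LacunarySymmetroid.MatrixDescartes`
(ledger item stmt-ValiantsHypothesis-18050).  ONE theorem about an arbitrary DESCARTES-SHARP real fewnomial, the
kernel form of theory-2 g14's **THEOREM N′ / WINDOW LEMMA** (memo `pub-symmetroid-theory-2/rows/law-g14/lz/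
THEOREM-NPRIME-t2g14.md`; READER PASS engine-1 g14), which strictly generalises the tree's `Census.newton_cone`
(the TERM-sharp case `Var = #terms − 1`) to fewnomials with sign repetitions:

`newton_window_of_alternating`: for `f = Σ_{t<n} c_t X^{e_t}` (`n ≥ 3`, `e` strictly increasing, all `c_t ≠ 0`)
with `#{t : c_t c_{t+1} < 0} ≤ #Z₊^{distinct}(f)` (Descartes-sharp: by Descartes' rule the left side, which is
`Var(f)`, is also an upper bound), and every consecutive triple with `c_i c_{i+1} < 0`, `c_{i+1} c_{i+2} < 0`:
`(|c_i| W_i)^{e_{i+2}−e_{i+1}} · (|c_{i+2}| W_{i+2})^{e_{i+1}−e_i} ≤ (|c_{i+1}| W_{i+1})^{e_{i+2}−e_i}`,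
`W_t = ∏_{u<n, u≠t} |e_t − e_u|` (written as a product over `range n` with the `u = t` factor set to `1`).

PROOF («END KILLS ONLY», as in the memo): induction on `n`, killing one END term outside the triple per step with
the Euler twist `X·f′ − E·f` at the end exponent `E`: an alternating end costs one positive root and one
alternation (the tree's `card_posRoots_le_card_posRoots_twist_succ`), a non-alternating end costs nothing
(`card_posRoots_le_card_posRoots_twist_of_endKill`, `…_topTwist_of_topKill` from the companion files), so
Descartes-sharpness is inherited; the killed gap factors `|e_t − E|` accumulate into the weights; the surviving
alternating trinomial has two positive roots and `trinomial_two_posRoots_le` (tree) is the inequality.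
Helpers: `coeff_rsum`, `coeff_rsum_self`, `coeff_rsum_eq_zero`, `twist_rsum`, `natDegree_rsum` for fewnomials
indexed by `range n`.  Census reading (theory-2 g14): every census eighteen (V = 18 on 21 terms) obeys the Newton
rows at its alternating triples (1 149/1 149 record rows checked, all failures at sign repetitions) — now a kernel
theorem about hypothetical nineteens as well.  Nothing here bears on `ζ_sym`, `DoorA26`/`DoorA34`, the crux, or
`VP ≠ VNP`.

[folklore] — the cell's own elementary theorem (theory-2 g14), on top of the tree's twisted Rolle / trinomial lemmas.
-/

-- `Summit.ValiantsHypothesis.ValiantsHypothesis.…` repeats a component by the D-0017 layout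
-- (single-conjunct summit), which the `dupNamespace` linter flags; the name is mandated.
set_option linter.dupNamespace false

namespace Summit.ValiantsHypothesis.ValiantsHypothesis.Theorems.LacunarySymmetroidMatrixDescartes.Census

open Polynomial Finset
open scoped BigOperators Polynomial

/-! ### Fewnomials indexed by `range n` -/

/-- Coefficients of `Σ_{t<n} c_t X^{e_t}`. [folklore] -/
theorem coeff_rsum (n : ℕ) (e : ℕ → ℕ) (c : ℕ → ℝ) (j : ℕ) :
    (∑ t ∈ range n, C (c t) * X ^ (e t) : ℝ[X]).coeff j = ∑ t ∈ range n, if j = e t then c t else 0 := by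
  rw [finsetSum_coeff]
  refine Finset.sum_congr rfl fun t _ => ?_
  rw [coeff_C_mul, coeff_X_pow]; split_ifs <;> simp

/-- The coefficient at `e_s` is `c_s` (exponents strictly increasing). [folklore] -/
theorem coeff_rsum_self {n : ℕ} (e : ℕ → ℕ) (he : StrictMono e) (c : ℕ → ℝ) {s : ℕ} (hs : s < n) :
    (∑ t ∈ range n, C (c t) * X ^ (e t) : ℝ[X]).coeff (e s) = c s := by
  rw [coeff_rsum, Finset.sum_eq_single s]
  · rw [if_pos rfl]
  · intro t _ hts; rw [if_neg]; exact fun h => hts (he.injective h).symm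
  · intro h; exact absurd (mem_range.mpr hs) h

/-- Coefficients off the exponent set vanish. [folklore] -/
theorem coeff_rsum_eq_zero {n : ℕ} (e : ℕ → ℕ) (c : ℕ → ℝ) {j : ℕ} (hj : ∀ t, t < n → e t ≠ j) :
    (∑ t ∈ range n, C (c t) * X ^ (e t) : ℝ[X]).coeff j = 0 := by
  rw [coeff_rsum]
  exact Finset.sum_eq_zero fun t ht => if_neg fun h => hj t (mem_range.mp ht) h.symm

/-- The Euler twist of `Σ_{t<n} c_t X^{e_t}` at weight `E`. [folklore] -/
theorem twist_rsum (n : ℕ) (e : ℕ → ℕ) (c : ℕ → ℝ) (E : ℝ) :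
    X * derivative (∑ t ∈ range n, C (c t) * X ^ (e t) : ℝ[X]) - C E * (∑ t ∈ range n, C (c t) * X ^ (e t))
      = ∑ t ∈ range n, C (c t * ((e t : ℝ) - E)) * X ^ (e t) := by
  ext k
  rw [coeff_X_mul_derivative_sub_C_mul, finsetSum_coeff, finsetSum_coeff, Finset.mul_sum]
  refine Finset.sum_congr rfl fun t _ => ?_
  simp only [coeff_C_mul, coeff_X_pow]
  split_ifs with h
  · subst h; ring
  · ring

/-- `natDegree` and leading coefficient of `Σ_{t<n} c_t X^{e_t}` (`n ≥ 1`, `c_{n-1} ≠ 0`). [folklore] -/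
theorem natDegree_rsum {n : ℕ} (hn : 1 ≤ n) (e : ℕ → ℕ) (he : StrictMono e) (c : ℕ → ℝ)
    (hc : c (n - 1) ≠ 0) :
    (∑ t ∈ range n, C (c t) * X ^ (e t) : ℝ[X]).natDegree = e (n - 1) := by
  apply natDegree_eq_of_le_of_coeff_ne_zero
  · rw [natDegree_le_iff_coeff_eq_zero]
    intro N hN
    apply coeff_rsum_eq_zero
    intro t ht hte
    have : e t ≤ e (n - 1) := he.monotone (by omega)
    omega
  · rw [coeff_rsum_self e he c (by omega)]; exact hc

/-! ### THEOREM N′ (theory-2 g14 WINDOW LEMMA): Newton's inequality at alternating triples of a Descartes-sharp fewnomial -/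

set_option maxHeartbeats 800000 in
/-- **THEOREM N′ / WINDOW LEMMA (kernel).**  Let `f = Σ_{t<n} c_t X^{e_t}` (`n ≥ 3`, `e` strictly increasing, all
`c_t ≠ 0`) be DESCARTES-SHARP in the sense that the number of ALTERNATING adjacent pairs
`#{t : c_t c_{t+1} < 0}` (= `Var(f)`) is at most the number of distinct positive roots of `f`.  Then at every
ALTERNATING consecutive triple `c_i c_{i+1} < 0`, `c_{i+1} c_{i+2} < 0` the Newton-cone inequality holds with the full
weights `W_t = ∏_{u ≠ t} |e_t − e_u|`:
`(|c_i| W_i)^{e_{i+2}−e_{i+1}} · (|c_{i+2}| W_{i+2})^{e_{i+1}−e_i} ≤ (|c_{i+1}| W_{i+1})^{e_{i+2}−e_i}`.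
(theory-2 g14, THEOREM-NPRIME-t2g14.md; READER PASS engine-1 g14.  The term-sharp case `Var = n − 1` is the tree's
`Census.newton_cone`.)  PROOF: «END KILLS ONLY» — kill the terms outside the triple one END at a time with the
Euler twist; an alternating end costs one root and one variation (`card_posRoots_le_card_posRoots_twist_succ`), a
non-alternating end costs nothing (`…_twist_of_endKill`, `…_topTwist_of_topKill`); the surviving trinomial has two
positive roots, and `trinomial_two_posRoots_le` is the inequality. [folklore] -/
theorem newton_window_of_alternating :
    ∀ (n : ℕ), 3 ≤ n → ∀ (e : ℕ → ℕ), StrictMono e → ∀ (c : ℕ → ℝ), (∀ t, t < n → c t ≠ 0) →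
      (∑ t ∈ range (n - 1), (if c t * c (t + 1) < 0 then 1 else 0)) ≤
        ((∑ t ∈ range n, C (c t) * X ^ (e t) : ℝ[X]).roots.toFinset.filter (fun x => 0 < x)).card →
      ∀ (i : ℕ), i + 2 < n → c i * c (i + 1) < 0 → c (i + 1) * c (i + 2) < 0 →
        (|c i| * ∏ u ∈ range n, (if u = i then 1 else |(e i : ℝ) - e u|)) ^ (e (i + 2) - e (i + 1)) *
          (|c (i + 2)| * ∏ u ∈ range n, (if u = i + 2 then 1 else |(e (i + 2) : ℝ) - e u|)) ^ (e (i + 1) - e i)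
        ≤ (|c (i + 1)| * ∏ u ∈ range n, (if u = i + 1 then 1 else |(e (i + 1) : ℝ) - e u|)) ^ (e (i + 2) - e i) := by
  intro n
  induction n using Nat.strong_induction_on with
  | _ n ih =>
  intro hn e he c hc hZ i hi h1 h2
  by_cases hn3 : n = 3
  · ------------------------------------------------------------ base: a trinomial with two positive roots
    subst hn3
    obtain rfl : i = 0 := by omega
    simp only [Nat.zero_add] at h1 h2 ⊢
    have he01 : e 0 < e 1 := he (by norm_num)
    have he12 : e 1 < e 2 := he (by norm_num)
    obtain ⟨a, ha⟩ : ∃ a, e 1 = e 0 + a := ⟨e 1 - e 0, by omega⟩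
    obtain ⟨b, hb⟩ : ∃ b, e 2 = e 1 + b := ⟨e 2 - e 1, by omega⟩
    have ha0 : 0 < a := by omega
    have hb0 : 0 < b := by omega
    -- two alternating pairs ⇒ two positive roots
    have hA : (∑ t ∈ range (3 - 1), (if c t * c (t + 1) < 0 then 1 else 0)) = 2 := by
      rw [show 3 - 1 = 2 from rfl, Finset.sum_range_succ, Finset.sum_range_succ, Finset.sum_range_zero,
        if_pos h1, if_pos h2]
    rw [hA] at hZ
    have hf3 : (∑ t ∈ range 3, C (c t) * X ^ (e t) : ℝ[X])
        = C (c 0) * X ^ (e 0) + C (c 1) * X ^ (e 0 + a) + C (c 2) * X ^ (e 0 + a + b) := by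
      rw [show e 0 + a + b = e 2 by omega, show e 0 + a = e 1 by omega,
        Finset.sum_range_succ, Finset.sum_range_succ, Finset.sum_range_succ, Finset.sum_range_zero, zero_add]
    rw [hf3] at hZ
    have htri := trinomial_two_posRoots_le (i := e 0) ha0 hb0 (c 0) (c 1) (c 2) (lt_of_lt_of_le one_lt_two hZ)
    -- weights: W0 = a(a+b), W1 = ab, W2 = (a+b)b
    have hab : (0 : ℝ) < a := by exact_mod_cast ha0
    have hbb : (0 : ℝ) < b := by exact_mod_cast hb0
    have c1r : ((e 1 : ℕ) : ℝ) = (e 0 : ℝ) + a := by rw [ha]; push_cast; ring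
    have c2r : ((e 2 : ℕ) : ℝ) = (e 0 : ℝ) + a + b := by rw [hb, ha]; push_cast; ring
    have hW0 : (∏ u ∈ range 3, (if u = 0 then 1 else |(e 0 : ℝ) - e u|)) = (a : ℝ) * (a + b) := by
      rw [Finset.prod_range_succ, Finset.prod_range_succ, Finset.prod_range_succ, Finset.prod_range_zero,
        if_pos rfl, if_neg (by norm_num), if_neg (by norm_num), c1r, c2r,
        show ((e 0 : ℝ) - ((e 0 : ℝ) + a)) = -a by ring, show ((e 0 : ℝ) - ((e 0 : ℝ) + a + b)) = -(a + b) by ring,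
        abs_neg, abs_neg, abs_of_pos hab, abs_of_pos (by positivity)]
      ring
    have hW1 : (∏ u ∈ range 3, (if u = 1 then 1 else |(e 1 : ℝ) - e u|)) = (a : ℝ) * b := by
      rw [Finset.prod_range_succ, Finset.prod_range_succ, Finset.prod_range_succ, Finset.prod_range_zero,
        if_neg (by norm_num), if_pos rfl, if_neg (by norm_num), c1r, c2r,
        show ((e 0 : ℝ) + a - e 0) = a by ring, show ((e 0 : ℝ) + a - ((e 0 : ℝ) + a + b)) = -b by ring, abs_neg,
        abs_of_pos hab, abs_of_pos hbb]
      ring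
    have hW2 : (∏ u ∈ range 3, (if u = 2 then 1 else |(e 2 : ℝ) - e u|)) = ((a : ℝ) + b) * b := by
      rw [Finset.prod_range_succ, Finset.prod_range_succ, Finset.prod_range_succ, Finset.prod_range_zero,
        if_neg (by norm_num), if_neg (by norm_num), if_pos rfl, c1r, c2r,
        show ((e 0 : ℝ) + a + b - e 0) = a + b by ring, show ((e 0 : ℝ) + a + b - ((e 0 : ℝ) + a)) = b by ring,
        abs_of_pos (by positivity), abs_of_pos hbb]
      ring
    rw [hW0, hW1, hW2, show e 2 - e 1 = b by omega, show e 1 - e 0 = a by omega, show e 2 - e 0 = a + b by omega]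
    -- `htri : (a+b)^{a+b} |c0|^b |c2|^a ≤ |c1|^{a+b} a^a b^b`; multiply by `a^b b^a`
    calc (|c 0| * ((a : ℝ) * (a + b))) ^ b * (|c 2| * (((a : ℝ) + b) * b)) ^ a
        = (((a : ℝ) + b) ^ (a + b) * |c 0| ^ b * |c 2| ^ a) * ((a : ℝ) ^ b * (b : ℝ) ^ a) := by
          rw [mul_pow, mul_pow, mul_pow, mul_pow, pow_add]; ring
      _ ≤ (|c 1| ^ (a + b) * (a : ℝ) ^ a * (b : ℝ) ^ b) * ((a : ℝ) ^ b * (b : ℝ) ^ a) :=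
          mul_le_mul_of_nonneg_right htri (by positivity)
      _ = (|c 1| * ((a : ℝ) * b)) ^ (a + b) := by rw [mul_pow, mul_pow, pow_add, pow_add]; ring
  · ------------------------------------------------------------ step: kill an end term outside the triple
    obtain ⟨k, rfl⟩ : ∃ k, n = k + 1 := ⟨n - 1, by omega⟩
    simp only [Nat.add_sub_cancel] at hZ
    have hk3 : 3 ≤ k := by omega
    have hei1 : e i < e (i + 1) := he (by omega)
    have hei2 : e (i + 1) < e (i + 2) := he (by omega)
    set f : ℝ[X] := ∑ t ∈ range (k + 1), C (c t) * X ^ (e t) with hf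
    by_cases hi1 : 1 ≤ i
    · ---------------------------------------------------------- bottom kill (index 0 ∉ triple)
      set E : ℝ := (e 0 : ℝ) with hE
      set c' : ℕ → ℝ := fun t => c (t + 1) * ((e (t + 1) : ℝ) - e 0) with hc'
      set e' : ℕ → ℕ := fun t => e (t + 1) with he'
      have he'm : StrictMono e' := fun a b hab => he (by simpa using hab)
      have hq : ∀ t, 0 < ((e (t + 1) : ℝ) - e 0) := by
        intro t
        have h' : e 0 < e (t + 1) := he (by omega)
        have h'' : (e 0 : ℝ) < e (t + 1) := by exact_mod_cast h'
        linarith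
      have hc'ne : ∀ t, t < k → c' t ≠ 0 := fun t ht => mul_ne_zero (hc (t + 1) (by omega)) (hq t).ne'
      have hsgn : ∀ t, (c' t * c' (t + 1) < 0 ↔ c (t + 1) * c (t + 1 + 1) < 0) := by
        intro t
        have hp := mul_pos (hq t) (hq (t + 1))
        have eq : c' t * c' (t + 1) = (c (t + 1) * c (t + 1 + 1)) * (((e (t + 1) : ℝ) - e 0) * ((e (t + 1 + 1) : ℝ) - e 0)) := by
          simp only [hc']; ring
        rw [eq]
        constructor
        · intro h; by_contra hge; rw [not_lt] at hge
          have := mul_nonneg hge hp.le; linarith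
        · intro h; exact mul_neg_of_neg_of_pos h hp
      -- the twisted polynomial is the `k`-term fewnomial with data `(e', c')`
      have hg : X * derivative f - C E * f = ∑ t ∈ range k, C (c' t) * X ^ (e' t) := by
        rw [hf, twist_rsum, Finset.sum_range_succ']
        simp only [hc', he', hE, sub_self, mul_zero, map_zero, zero_mul, add_zero]
      -- root count of the twist
      have he01 : e 0 < e 1 := he (by norm_num)
      have hZg : (∑ t ∈ range (k - 1), (if c' t * c' (t + 1) < 0 then 1 else 0)) ≤
          ((∑ t ∈ range k, C (c' t) * X ^ (e' t) : ℝ[X]).roots.toFinset.filter (fun x => 0 < x)).card := by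
        rw [← hg]
        have hsplit : (∑ t ∈ range k, (if c t * c (t + 1) < 0 then 1 else 0))
            = (if c 0 * c 1 < 0 then 1 else 0) + ∑ t ∈ range (k - 1), (if c' t * c' (t + 1) < 0 then 1 else 0) := by
          obtain ⟨k', hk'⟩ : ∃ k', k = k' + 1 := ⟨k - 1, by omega⟩
          rw [hk', Finset.sum_range_succ', Nat.add_sub_cancel, add_comm]
          congr 1
          exact Finset.sum_congr rfl fun t _ => by simp only [hsgn]
        rw [hsplit] at hZ
        by_cases h01 : c 0 * c 1 < 0
        · rw [if_pos h01] at hZ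
          have := card_posRoots_le_card_posRoots_twist_succ f E
          omega
        · rw [if_neg h01, zero_add] at hZ
          have h01' : 0 < c 0 * c 1 :=
            lt_of_le_of_ne (not_lt.mp h01) (Ne.symm (mul_ne_zero (hc 0 (by omega)) (hc 1 (by omega))))
          have hlow : ∀ j, j < e 0 → f.coeff j = 0 := by
            intro j hj; apply coeff_rsum_eq_zero; intro t _ hte
            have : e 0 ≤ e t := he.monotone (Nat.zero_le t); omega
          have hgap : ∀ j, e 0 < j → j < e 0 + (e 1 - e 0) → f.coeff j = 0 := by
            intro j hj1 hj2; apply coeff_rsum_eq_zero; intro t _ hte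
            rcases Nat.lt_or_ge t 1 with h0 | h1'
            · have ht0 : t = 0 := by omega
              subst ht0; omega
            · have : e 1 ≤ e t := he.monotone h1'; omega
          have hsame : 0 < f.coeff (e 0) * f.coeff (e 0 + (e 1 - e 0)) := by
            rw [show e 0 + (e 1 - e 0) = e 1 by omega, coeff_rsum_self e he c (show 0 < k + 1 by omega),
              coeff_rsum_self e he c (show 1 < k + 1 by omega)]; exact h01'
          have hek := card_posRoots_le_card_posRoots_twist_of_endKill f (show 1 ≤ e 1 - e 0 by omega) hlow hgap hsame
          exact hZ.trans hek
      -- induction hypothesis on the `k`-term fewnomial, triple `(i-1, i, i+1)`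
      have h1' : c' (i - 1) * c' (i - 1 + 1) < 0 := by
        rw [hsgn, show i - 1 + 1 = i by omega]; exact h1
      have h2' : c' (i - 1 + 1) * c' (i - 1 + 2) < 0 := by
        rw [show i - 1 + 2 = i - 1 + 1 + 1 by omega, hsgn, show i - 1 + 1 = i by omega]; exact h2
      have hIH := ih k (by omega) hk3 e' he'm c' hc'ne hZg (i - 1) (by omega) h1' h2'
      -- translate weights: |c' t| W' t = |c (t+1)| W (t+1)
      have hWt : ∀ t, |c' t| * ∏ u ∈ range k, (if u = t then 1 else |(e' t : ℝ) - e' u|)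
            = |c (t + 1)| * ∏ u ∈ range (k + 1), (if u = t + 1 then 1 else |(e (t + 1) : ℝ) - e u|) := by
        intro t
        rw [Finset.prod_range_succ']
        simp only [hc', he', show (0 : ℕ) ≠ t + 1 by omega, if_false, abs_mul, abs_of_pos (hq t),
          Nat.succ_inj]
        ring
      rw [show i - 1 + 2 = i + 1 by omega, show i - 1 + 1 = i by omega, hWt, hWt, hWt] at hIH
      simp only [he'] at hIH
      rw [show i - 1 + 1 = i by omega, show i + 1 + 1 = i + 2 by omega] at hIH
      exact hIH
    · ---------------------------------------------------------- top kill (index k ∉ triple, since i = 0, k ≥ 3)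
      obtain rfl : i = 0 := by omega
      simp only [Nat.zero_add] at h1 h2 hei1 hei2 ⊢
      set E : ℝ := (e k : ℝ) with hE
      set c' : ℕ → ℝ := fun t => c t * ((e t : ℝ) - e k) with hc'
      have hq : ∀ t, t < k → ((e t : ℝ) - e k) < 0 := by
        intro t ht
        have h' : e t < e k := he ht
        have h'' : (e t : ℝ) < e k := by exact_mod_cast h'
        linarith
      have hc'ne : ∀ t, t < k → c' t ≠ 0 := fun t ht => mul_ne_zero (hc t (by omega)) (hq t ht).ne
      have hsgn : ∀ t, t + 1 < k → (c' t * c' (t + 1) < 0 ↔ c t * c (t + 1) < 0) := by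
        intro t ht
        have hp := mul_pos_of_neg_of_neg (hq t (by omega)) (hq (t + 1) ht)
        have eq : c' t * c' (t + 1) = (c t * c (t + 1)) * (((e t : ℝ) - e k) * ((e (t + 1) : ℝ) - e k)) := by
          simp only [hc']; ring
        rw [eq]
        constructor
        · intro h; by_contra hge; rw [not_lt] at hge
          have := mul_nonneg hge hp.le; linarith
        · intro h; exact mul_neg_of_neg_of_pos h hp
      have hg : X * derivative f - C E * f = ∑ t ∈ range k, C (c' t) * X ^ (e t) := by
        rw [hf, twist_rsum, Finset.sum_range_succ]
        simp only [hc', hE, sub_self, mul_zero, map_zero, zero_mul, add_zero]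
      have hZg : (∑ t ∈ range (k - 1), (if c' t * c' (t + 1) < 0 then 1 else 0)) ≤
          ((∑ t ∈ range k, C (c' t) * X ^ (e t) : ℝ[X]).roots.toFinset.filter (fun x => 0 < x)).card := by
        rw [← hg]
        obtain ⟨k', hk'⟩ : ∃ k', k = k' + 1 := ⟨k - 1, by omega⟩
        have hsplit : (∑ t ∈ range k, (if c t * c (t + 1) < 0 then 1 else 0))
            = (∑ t ∈ range (k - 1), (if c' t * c' (t + 1) < 0 then 1 else 0)) +
              (if c k' * c (k' + 1) < 0 then 1 else 0) := by
          rw [hk', Finset.sum_range_succ, Nat.add_sub_cancel]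
          congr 1
          exact Finset.sum_congr rfl fun t ht => by
            have ht' := mem_range.mp ht
            simp only [hsgn t (by omega)]
        rw [hsplit] at hZ
        by_cases htop : c k' * c (k' + 1) < 0
        · rw [if_pos htop] at hZ
          have := card_posRoots_le_card_posRoots_twist_succ f E
          omega
        · rw [if_neg htop, add_zero] at hZ
          have htop' : 0 < c k' * c (k' + 1) :=
            lt_of_le_of_ne (not_lt.mp htop) (Ne.symm (mul_ne_zero (hc k' (by omega)) (hc (k' + 1) (by omega))))
          have hdeg : f.natDegree = e k := by
            have := natDegree_rsum (show 1 ≤ k + 1 by omega) e he c (by rw [Nat.add_sub_cancel]; exact hc k (by omega))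
            rw [Nat.add_sub_cancel] at this; exact this
          have hlead : f.leadingCoeff = c k := by
            rw [leadingCoeff, hdeg, coeff_rsum_self e he c (show k < k + 1 by omega)]
          have hem : e k' < e k := he (by omega)
          have hgap : ∀ j, f.natDegree - (e k - e k') < j → j < f.natDegree → f.coeff j = 0 := by
            intro j hj1 hj2; rw [hdeg] at hj1 hj2
            apply coeff_rsum_eq_zero; intro t ht hte
            rcases Nat.lt_or_ge t k' with hlt | hge
            · have : e t < e k' := he hlt; omega
            · rcases Nat.lt_or_ge t k with hlt2 | hge2
              · have htk : t = k' := by omega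
                subst htk; omega
              · have htk : t = k := by omega
                subst htk; omega
          have hsame : 0 < f.leadingCoeff * f.coeff (f.natDegree - (e k - e k')) := by
            have hkk : k' + 1 = k := by omega
            rw [hlead, hdeg, show e k - (e k - e k') = e k' by omega,
              coeff_rsum_self e he c (show k' < k + 1 by omega), mul_comm]
            rw [hkk] at htop'; exact htop'
          have htk := card_posRoots_le_card_posRoots_topTwist_of_topKill f (show 1 ≤ e k - e k' by omega)
            (by rw [hdeg]; omega) hgap hsame
          rw [hdeg] at htk
          exact hZ.trans htk
      have h1' : c' 0 * c' (0 + 1) < 0 := by rw [hsgn 0 (by omega)]; exact h1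
      have h2' : c' (0 + 1) * c' (0 + 2) < 0 := by rw [Nat.zero_add, hsgn 1 (by omega)]; exact h2
      have hIH := ih k (by omega) hk3 e he c' hc'ne hZg 0 (by omega) h1' h2'
      have hWt : ∀ t, t < k → |c' t| * ∏ u ∈ range k, (if u = t then 1 else |(e t : ℝ) - e u|)
            = |c t| * ∏ u ∈ range (k + 1), (if u = t then 1 else |(e t : ℝ) - e u|) := by
        intro t ht
        rw [Finset.prod_range_succ, if_neg (by omega)]
        simp only [hc', abs_mul]
        rw [abs_of_neg (hq t ht)]
        ring
      simp only [Nat.zero_add] at hIH ⊢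
      rw [hWt 0 (by omega), hWt 1 (by omega), hWt 2 (by omega)] at hIH
      exact hIH

end Summit.ValiantsHypothesis.ValiantsHypothesis.Theorems.LacunarySymmetroidMatrixDescartes.Census
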